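import Summits.CriticalPhenomena.PercolationContinuityZ3.Theorems.PercNearOneGluingNoHeavyLowerTailSahiTransportLast

/-!
# `NoHeavyLowerTail` (crux stmt-CriticalPhenomena-4575), Sahi / Kahn positivity: TRANSPORT CERTIFICATES (V-b) —
# adjoining a coordinate CONJUNCTIVELY preserves certificates: `H_k ↦ H_k ∧ x_k`

Support file (cell `prim-l12`, seat P3, gen 7; `--supports stmt-CriticalPhenomena-4575`).  No `sorry`, no named facts, standard axioms.
New mathematics (this programme).

`…SahiTransportCert`: a TRANSPORT CERTIFICATE `Π` for the pattern event `H_k ⊆ 2^{Fin k}` at parameters `q` (a nonnegative kernel on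
`{S ⊆ T, S ∉ H_k, T ∈ H_k}` with row sums `θ w(S)`, column sums `≤ (2 − θ) w(T)` and the transport condition (TC) on all pairs of
up-sets) gives Kahn's Conjecture 5 / Sahi's `C₃` for the junta slot and ALL increasing `U, V` in every dimension.
THIS FILE (`transportCert_andLast`): if `Π` certifies the up-set `H_k` at `q|_{Fin k}` then the division-free kernel
  `Π∧((S,0),(T,1)) = p q̄ Π(S,T) + θ' p q̄ w'(S)·[T = S ∈ H_k]`,  `Π∧((S,1),(T,1)) = p² Π(S,T)`  (`p = q_k`, `q̄ = 1 − p`, `θ' = w'(H_k)`)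
certifies `H_k ∧ x_k = {S : rest S ∈ H_k, k ∈ S}` at `q`.  Rows and columns are bookkeeping; the transport condition of `Π∧` at a
pair of up-sets `𝒳, 𝒵` of `2^{Fin (k+1)}` with sections `X₀ ⊆ X₁`, `Z₀ ⊆ Z₁` is the explicit nonnegative combination
  `tcRHS − LHS = p·[(TC) of Π at (X₁,Z₁)] + θ' p q̄²·(μ'X₁ − μ'X₀)(μ'Z₁ − μ'Z₀) + p q̄·(μ'X₁ − μ'X₀)(μ'(H_k∩Z₁) − θ'μ'Z₁)
               + p q̄·(μ'(H_k∩X₁) − θ'μ'X₁)(μ'Z₁ − μ'Z₀)`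
(Harris for `H_k` and the sections, monotonicity of the sections).  Found by an exact LP over formal bilinear identities (seat
code/formal3.py) and verified symbolically; the companion `…SahiTransportCascade` does `∨` and draws the consequences. [this work]
-/

noncomputable section

open scoped Classical

namespace Summit.CriticalPhenomena.PercolationContinuityZ3.Theorems

namespace SahiTransportCert

open Finset
open SahiHittingSlot
open Literature.Combinatorics.Sahi2008
open Literature.Probability.Percolation.BHK2006 (weight)
open Literature.Probability.Percolation.DecisionTree (ind ind_of_mem ind_of_not_mem ind_nonneg)

variable {k : ℕ}

/-! ### Adjoining the last coordinate conjunctively: `H_k ∧ x_k` -/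

section AndLast

variable (q : Fin (k + 1) → unitInterval) (Hk : Set (Set (Fin k))) (Kr : Set (Fin k) → Set (Fin k) → ℝ)

/-- `H_k ∧ x_k ⊆ 2^{Fin (k+1)}`: the `Fin k`-part lies in `H_k` AND the last coordinate is open. [this work] -/
def andLast : Set (Set (Fin (k + 1))) := {S | rest S ∈ Hk ∧ Fin.last k ∈ S}

omit q Kr in
/-- `andLast` of an up-set is an up-set. [this work] -/
theorem isUpperSet_andLast (h : IsUpperSet Hk) : IsUpperSet (andLast Hk) :=
  fun _ _ hle hS => ⟨h (Set.preimage_mono hle) hS.1, hle hS.2⟩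

omit q Kr in
/-- The closed section of `H_k ∧ x_k` is empty. [this work] -/
@[simp] theorem sec0_andLast : sec0 (andLast Hk) = ∅ :=
  Set.eq_empty_of_forall_notMem fun S hS => last_not_mem_lo S hS.2

omit q Kr in
/-- The open section of `H_k ∧ x_k` is `H_k`. [this work] -/
@[simp] theorem sec1_andLast : sec1 (andLast Hk) = Hk := by
  ext S; simp [andLast]

omit Kr in
/-- `μ(H_k ∧ x_k) = p·μ'(H_k)`. [this work] -/
theorem pr_andLast : pr q (andLast Hk) = plast q * pr (qinit q) Hk := by
  rw [pr_eq_sec, sec0_andLast, sec1_andLast, pr_empty]; ring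

/-- The kernel for `H_k ∧ x_k` (division-free): `Π∧((S,0),(T,1)) = p q̄ Π(S,T) + θ' p q̄ w'(S)[T = S ∈ H_k]`,
`Π∧((S,1),(T,1)) = p² Π(S,T)`, all other entries `0`. [this work] -/
def krAnd (S T : Set (Fin (k + 1))) : ℝ :=
  if Fin.last k ∈ T then
    if Fin.last k ∈ S then plast q ^ 2 * Kr (rest S) (rest T)
    else plast q * (1 - plast q) * Kr (rest S) (rest T) +
      (if rest T = rest S ∧ rest S ∈ Hk then pr (qinit q) Hk * plast q * (1 - plast q) * bernoulliWeight (qinit q) (rest S) else 0)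
  else 0

/-- Kernel values on lifted patterns. [this work] -/
@[simp] theorem krAnd_lo_lo (S T : Set (Fin k)) : krAnd q Hk Kr (lo S) (lo T) = 0 := by simp [krAnd]

/-- Kernel values on lifted patterns. [this work] -/
@[simp] theorem krAnd_hi_lo (S T : Set (Fin k)) : krAnd q Hk Kr (hi S) (lo T) = 0 := by simp [krAnd]

/-- Kernel values on lifted patterns. [this work] -/
@[simp] theorem krAnd_hi_hi (S T : Set (Fin k)) : krAnd q Hk Kr (hi S) (hi T) = plast q ^ 2 * Kr S T := by simp [krAnd]

/-- Kernel values on lifted patterns. [this work] -/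
@[simp] theorem krAnd_lo_hi (S T : Set (Fin k)) : krAnd q Hk Kr (lo S) (hi T) = plast q * (1 - plast q) * Kr S T +
    (if T = S ∧ S ∈ Hk then pr (qinit q) Hk * plast q * (1 - plast q) * bernoulliWeight (qinit q) S else 0) := by
  simp [krAnd]

/-- **ADJOINING A COORDINATE BY `∧` PRESERVES CERTIFICATES**: if `Π` is a transport certificate for the up-set `H_k` at `q|_{Fin k}`,
then `Π∧` is one for `H_k ∧ x_k` at `q`. [this work] -/
theorem transportCert_andLast (hH : IsUpperSet Hk) (h : TransportCert (qinit q) Hk Kr) : TransportCert q (andLast Hk) (krAnd q Hk Kr) := by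
  have hp0 : 0 ≤ plast q := plast_nonneg q
  have hp1 : plast q ≤ 1 := plast_le_one q
  have hθ'0 : 0 ≤ pr (qinit q) Hk := pr_nonneg _ Hk
  have hθ'1 : pr (qinit q) Hk ≤ 1 := pr_le_one _ Hk
  have hrow0 : ∀ S, S ∈ Hk → ∀ T, Kr S T = 0 := fun S hS T => by by_contra hne; exact h.offH S T hne hS
  have hθ : pr q (andLast Hk) = plast q * pr (qinit q) Hk := pr_andLast q Hk
  refine ⟨?_, ?_, ?_, ?_, ?_, ?_, ?_⟩
  · -- nonnegativity
    intro S T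
    unfold krAnd
    split_ifs
    · exact mul_nonneg (sq_nonneg _) (h.nonneg _ _)
    · exact add_nonneg (mul_nonneg (mul_nonneg hp0 (by linarith)) (h.nonneg _ _))
        (mul_nonneg (mul_nonneg (mul_nonneg hθ'0 hp0) (by linarith)) (bw_nonneg _ _))
    · exact add_nonneg (mul_nonneg (mul_nonneg hp0 (by linarith)) (h.nonneg _ _)) le_rfl
    · exact le_rfl
  · -- upward
    refine pattern_cases (fun S => pattern_cases (fun T hne => ?_) (fun T hne => ?_)) (fun S => pattern_cases (fun T hne => ?_) (fun T hne => ?_))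
    · simp at hne
    · rw [krAnd_lo_hi] at hne
      refine lo_subset_hi.2 ?_
      by_cases hK : Kr S T = 0
      · rw [hK, mul_zero, zero_add] at hne
        by_cases hc : T = S ∧ S ∈ Hk
        · exact hc.1 ▸ subset_rfl
        · rw [if_neg hc] at hne; exact (hne rfl).elim
      · exact h.subset S T hK
    · simp at hne
    · rw [krAnd_hi_hi] at hne
      exact hi_subset_hi.2 (h.subset S T (right_ne_zero_of_mul hne))
  · -- sources outside
    refine pattern_cases (fun S => pattern_cases (fun T hne => ?_) (fun T hne hS => ?_)) (fun S => pattern_cases (fun T hne => ?_) (fun T hne hS => ?_))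
    · simp at hne
    · exact last_not_mem_lo S hS.2
    · simp at hne
    · rw [krAnd_hi_hi] at hne
      have hS' : S ∈ Hk := by simpa [andLast] using hS
      exact right_ne_zero_of_mul hne (hrow0 S hS' T)
  · -- targets inside
    refine pattern_cases (fun S => pattern_cases (fun T hne => ?_) (fun T hne => ?_)) (fun S => pattern_cases (fun T hne => ?_) (fun T hne => ?_))
    · simp at hne
    · rw [krAnd_lo_hi] at hne
      refine ⟨?_, last_mem_hi T⟩
      rw [rest_hi]
      by_cases hK : Kr S T = 0
      · rw [hK, mul_zero, zero_add] at hne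
        by_cases hc : T = S ∧ S ∈ Hk
        · exact hc.1 ▸ hc.2
        · rw [if_neg hc] at hne; exact (hne rfl).elim
      · exact h.memH S T hK
    · simp at hne
    · rw [krAnd_hi_hi] at hne
      exact ⟨by rw [rest_hi]; exact h.memH S T (right_ne_zero_of_mul hne), last_mem_hi T⟩
  · -- row sums
    refine pattern_cases (fun S hS => ?_) (fun S hS => ?_)
    · rw [sum_set_succ, hθ, bw_lo]
      simp only [krAnd_lo_lo, krAnd_lo_hi, zero_add, sum_add_distrib, ← mul_sum, sum_ite_eq_and]
      by_cases hSH : S ∈ Hk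
      · rw [if_pos hSH, sum_eq_zero fun T _ => hrow0 S hSH T]; ring
      · rw [if_neg hSH, h.row S hSH]; ring
    · have hS' : S ∉ Hk := fun h' => hS ⟨by rwa [rest_hi], last_mem_hi S⟩
      rw [sum_set_succ, hθ, bw_hi]
      simp only [krAnd_hi_lo, krAnd_hi_hi, zero_add, ← mul_sum, h.row S hS']
      ring
  · -- column sums
    refine pattern_cases (fun T => ?_) (fun T => ?_)
    · rw [sum_set_succ]
      simp only [krAnd_lo_lo, krAnd_hi_lo, add_zero, sum_const_zero]
      exact mul_nonneg (by linarith [pr_le_one q (andLast Hk)]) (bw_nonneg q _)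
    · have hcolsum : ∑ S, krAnd q Hk Kr S (hi T) = plast q * ∑ S, Kr S T +
          (if T ∈ Hk then pr (qinit q) Hk * plast q * (1 - plast q) * bernoulliWeight (qinit q) T else 0) := by
        rw [sum_set_succ]
        simp only [krAnd_lo_hi, krAnd_hi_hi, sum_add_distrib]
        rw [sum_ite_eq_and' T (fun S => S ∈ Hk) (fun S => pr (qinit q) Hk * plast q * (1 - plast q) * bernoulliWeight (qinit q) S),
          ← mul_sum, ← mul_sum, mul_sum, mul_sum, mul_sum]
        have : ∀ S : Set (Fin k), plast q * (1 - plast q) * Kr S T + plast q ^ 2 * Kr S T = plast q * Kr S T := fun S => by ring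
        rw [add_right_comm, ← sum_add_distrib, sum_congr rfl fun S _ => this S]
      rw [hcolsum, hθ, bw_hi]
      have hcol := h.col T
      have hite : (if T ∈ Hk then pr (qinit q) Hk * plast q * (1 - plast q) * bernoulliWeight (qinit q) T else 0) ≤
          pr (qinit q) Hk * plast q * (1 - plast q) * bernoulliWeight (qinit q) T := by
        split_ifs
        · exact le_rfl
        · exact mul_nonneg (mul_nonneg (mul_nonneg hθ'0 hp0) (by linarith)) (bw_nonneg _ T)
      have hw := bw_nonneg (qinit q) T
      nlinarith [mul_le_mul_of_nonneg_left hcol hp0]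
  · -- the transport condition
    intro 𝒳 𝒵 h𝒳 h𝒵
    have hX₁ : IsUpperSet (sec1 𝒳) := isUpperSet_sec1 h𝒳
    have hZ₁ : IsUpperSet (sec1 𝒵) := isUpperSet_sec1 h𝒵
    have hX01 : sec0 𝒳 ⊆ sec1 𝒳 := sec0_subset_sec1 h𝒳
    have hZ01 : sec0 𝒵 ⊆ sec1 𝒵 := sec0_subset_sec1 h𝒵
    -- the left-hand side through the sections
    have inner : ∀ S : Set (Fin (k + 1)), ∑ T, krAnd q Hk Kr S T * ind (𝒳 ∩ 𝒵) T =
        ∑ T : Set (Fin k), krAnd q Hk Kr S (hi T) * ind (sec1 𝒳 ∩ sec1 𝒵) T := by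
      intro S
      rw [sum_set_succ]
      refine sum_congr rfl fun T _ => ?_
      rw [ind_hi, sec1_inter]
      have : krAnd q Hk Kr S (lo T) = 0 := by simp [krAnd]
      rw [this, zero_mul, zero_add]
    have rowlo : ∀ S : Set (Fin k), ∑ T : Set (Fin k), krAnd q Hk Kr (lo S) (hi T) * ind (sec1 𝒳 ∩ sec1 𝒵) T =
        plast q * (1 - plast q) * ∑ T, Kr S T * ind (sec1 𝒳 ∩ sec1 𝒵) T +
          pr (qinit q) Hk * plast q * (1 - plast q) * (bernoulliWeight (qinit q) S * ind Hk S * ind (sec1 𝒳 ∩ sec1 𝒵) S) := by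
      intro S
      simp only [krAnd_lo_hi, add_mul, sum_add_distrib, mul_sum]
      congr 1
      · exact sum_congr rfl fun T _ => by ring
      · have : ∀ T : Set (Fin k), (if T = S ∧ S ∈ Hk then pr (qinit q) Hk * plast q * (1 - plast q) * bernoulliWeight (qinit q) S else 0) *
            ind (sec1 𝒳 ∩ sec1 𝒵) T = if T = S then pr (qinit q) Hk * plast q * (1 - plast q) *
              (bernoulliWeight (qinit q) S * ind Hk S * ind (sec1 𝒳 ∩ sec1 𝒵) S) else 0 := by
          intro T
          by_cases hT : T = S
          · subst hT
            by_cases hc : T ∈ Hk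
            · simp [hc, ind_of_mem hc]; ring
            · simp [hc, ind_of_not_mem hc]
          · simp [hT]
        simp_rw [this]
        rw [Finset.sum_ite_eq' Finset.univ S, if_pos (mem_univ S)]
    have rowhi : ∀ S : Set (Fin k), ∑ T : Set (Fin k), krAnd q Hk Kr (hi S) (hi T) * ind (sec1 𝒳 ∩ sec1 𝒵) T =
        plast q ^ 2 * ∑ T, Kr S T * ind (sec1 𝒳 ∩ sec1 𝒵) T := by
      intro S
      simp only [krAnd_hi_hi, mul_sum]
      exact sum_congr rfl fun T _ => by ring
    have hL : ∑ S, ∑ T, krAnd q Hk Kr S T * ind (𝒳 ∩ 𝒵) T =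
        plast q * ∑ S, ∑ T, Kr S T * ind (sec1 𝒳 ∩ sec1 𝒵) T +
          pr (qinit q) Hk * plast q * (1 - plast q) * pr (qinit q) (Hk ∩ (sec1 𝒳 ∩ sec1 𝒵)) := by
      simp only [inner]
      rw [sum_set_succ]
      simp only [rowlo, rowhi]
      rw [pr_inter_eq_sum, Finset.mul_sum, Finset.mul_sum, ← Finset.sum_add_distrib]
      refine sum_congr rfl fun S _ => ?_
      ring
    -- the right-hand side through the sections
    have eXZ : pr q (𝒳 ∩ 𝒵) = (1 - plast q) * pr (qinit q) (sec0 𝒳 ∩ sec0 𝒵) + plast q * pr (qinit q) (sec1 𝒳 ∩ sec1 𝒵) := by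
      rw [pr_eq_sec, sec0_inter, sec1_inter]
    have eX : pr q 𝒳 = (1 - plast q) * pr (qinit q) (sec0 𝒳) + plast q * pr (qinit q) (sec1 𝒳) := pr_eq_sec q 𝒳
    have eZ : pr q 𝒵 = (1 - plast q) * pr (qinit q) (sec0 𝒵) + plast q * pr (qinit q) (sec1 𝒵) := pr_eq_sec q 𝒵
    have eHXZ : pr q ((andLast Hk)ᶜ ∩ (𝒳 ∩ 𝒵)) = (1 - plast q) * pr (qinit q) (sec0 𝒳 ∩ sec0 𝒵) +
        plast q * (pr (qinit q) (sec1 𝒳 ∩ sec1 𝒵) - pr (qinit q) (Hk ∩ (sec1 𝒳 ∩ sec1 𝒵))) := by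
      rw [pr_eq_sec, sec0_inter, sec1_inter, sec0_compl, sec1_compl, sec0_andLast, sec1_andLast, sec0_inter, sec1_inter,
        Set.compl_empty, Set.univ_inter, pr_compl_inter]
    have eHX : pr q ((andLast Hk)ᶜ ∩ 𝒳) = (1 - plast q) * pr (qinit q) (sec0 𝒳) + plast q * (pr (qinit q) (sec1 𝒳) - pr (qinit q) (Hk ∩ sec1 𝒳)) := by
      rw [pr_eq_sec, sec0_inter, sec1_inter, sec0_compl, sec1_compl, sec0_andLast, sec1_andLast, Set.compl_empty, Set.univ_inter,
        pr_compl_inter]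
    have eHZ : pr q ((andLast Hk)ᶜ ∩ 𝒵) = (1 - plast q) * pr (qinit q) (sec0 𝒵) + plast q * (pr (qinit q) (sec1 𝒵) - pr (qinit q) (Hk ∩ sec1 𝒵)) := by
      rw [pr_eq_sec, sec0_inter, sec1_inter, sec0_compl, sec1_compl, sec0_andLast, sec1_andLast, Set.compl_empty, Set.univ_inter,
        pr_compl_inter]
    -- the ingredients on the `k`-cube
    have htc := h.tc (sec1 𝒳) (sec1 𝒵) hX₁ hZ₁
    rw [pr_compl_inter, pr_compl_inter, pr_compl_inter] at htc
    have hT6X : pr (qinit q) Hk * pr (qinit q) (sec1 𝒳) ≤ pr (qinit q) (Hk ∩ sec1 𝒳) := pr_mul_pr_le_pr_inter _ hH hX₁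
    have hT6Z : pr (qinit q) Hk * pr (qinit q) (sec1 𝒵) ≤ pr (qinit q) (Hk ∩ sec1 𝒵) := pr_mul_pr_le_pr_inter _ hH hZ₁
    have hmX : pr (qinit q) (sec0 𝒳) ≤ pr (qinit q) (sec1 𝒳) := pr_mono _ hX01
    have hmZ : pr (qinit q) (sec0 𝒵) ≤ pr (qinit q) (sec1 𝒵) := pr_mono _ hZ01
    rw [hL, hθ, eXZ, eX, eZ, eHXZ, eHX, eHZ]
    nlinarith [mul_nonneg hp0 (sub_nonneg.2 htc),
      mul_nonneg (mul_nonneg (mul_nonneg hθ'0 hp0) (sq_nonneg (1 - plast q))) (mul_nonneg (sub_nonneg.2 hmX) (sub_nonneg.2 hmZ)),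
      mul_nonneg (mul_nonneg hp0 (sub_nonneg.2 hp1)) (mul_nonneg (sub_nonneg.2 hmX) (sub_nonneg.2 hT6Z)),
      mul_nonneg (mul_nonneg hp0 (sub_nonneg.2 hp1)) (mul_nonneg (sub_nonneg.2 hT6X) (sub_nonneg.2 hmZ))]

end AndLast

end SahiTransportCert

end Summit.CriticalPhenomena.PercolationContinuityZ3.Theorems
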